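import Mathlib.Combinatorics.SetFamily.Compression.Down
import Mathlib.Logic.Equiv.Basic
import HarnessLib

/-!
# Relative down-compression inside an ambient set family — definitions (support file for THEOREM S^rel / LEMMA I**)

Support file (prover seat `prim-bnk-2`, gen 31; `--supports stmt-CriticalPhenomena-4575`).  Memo:
`run/shared/lean/prim/prim-l12/FROM-prim-bnk-2-g31-COMPRESSION-THEOREM.md` §1.

For an ambient family `Q`, the **relative down-compression** `relCompression Q a 𝒜` removes `a` from a member of `𝒜`
when the result lies in `Q` and is not already a member (Mathlib's `Down.compression a` is the case `Q = univ`).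
This file holds the two plumbing definitions of the relative shift-determinant theorem (companion files
`…SahiMasterFamilyFCombRelCompression` — lemmas — and `…SahiMasterFamilyFCombRelShiftDet` — THEOREM S^rel):
`relCompression` with its membership lemma, and the regrouping equivalence `relRegroup`
(`𝒩⁰ ⊕ 𝒩¹ ≃ 𝒢⁰ ⊕ 𝒢¹` for the split of an iterated relative compression along a coordinate).  No `sorry`; standard axioms.
-/

namespace Summit.CriticalPhenomena.PercolationContinuityZ3.Theorems

namespace SahiFComb.Shift

open Finset FinsetFamily

variable {α : Type*} [DecidableEq α]

/-- Relative down-compression of `𝒜` along `a` inside the ambient family `Q`: a member `s` of `𝒜` is replaced by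
`s.erase a` when `s.erase a ∈ Q` and `s.erase a ∉ 𝒜`; all other members stay. [this work] -/
def relCompression (Q : Finset (Finset α)) (a : α) (𝒜 : Finset (Finset α)) : Finset (Finset α) :=
  {s ∈ 𝒜 | s.erase a ∈ 𝒜 ∨ s.erase a ∉ Q}.disjUnion {s ∈ 𝒜.image fun s => s.erase a | s ∉ 𝒜 ∧ s ∈ Q} <|
    disjoint_left.2 fun _s h₁ h₂ => (mem_filter.1 h₂).2.1 (mem_filter.1 h₁).1

/-- Membership in the relative down-compression. [this work] -/
theorem mem_relCompression {Q 𝒜 : Finset (Finset α)} {a : α} {s : Finset α} :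
    s ∈ relCompression Q a 𝒜 ↔
      s ∈ 𝒜 ∧ (s.erase a ∈ 𝒜 ∨ s.erase a ∉ Q) ∨ s ∉ 𝒜 ∧ insert a s ∈ 𝒜 ∧ s ∈ Q := by
  simp only [relCompression, mem_disjUnion, mem_filter, mem_image]
  constructor
  · rintro (h | ⟨⟨t, ht, rfl⟩, hts, htQ⟩)
    · exact Or.inl h
    · refine Or.inr ⟨hts, ?_, htQ⟩
      have hat : a ∈ t := by
        by_contra hat
        rw [erase_eq_of_notMem hat] at hts
        exact hts ht
      rwa [insert_erase hat]
  · rintro (h | ⟨hs, hins, hsQ⟩)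
    · exact Or.inl h
    · refine Or.inr ⟨⟨insert a s, hins, ?_⟩, hs, hsQ⟩
      have has : a ∉ s := fun has => hs (by rwa [insert_eq_of_mem has] at hins)
      exact erase_insert has

/-- Regrouping for the relative split: `𝒩⁰ ⊕ 𝒩¹ ≃ 𝒢⁰ ⊕ 𝒢¹` where `𝒩⁰ = 𝒢⁰ ∪ {K ∈ 𝒢¹ : K ∈ Q}` and
`𝒩¹ = {K ∈ 𝒢¹ : K ∈ 𝒢 ∨ K ∉ Q}`, for families `𝒢⁰, 𝒢¹` of sets with `𝒢⁰ = {K ∈ 𝒢 : …}`-type side conditions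
supplied as hypotheses (`inl K ↦ inl K` if `K ∈ 𝒢⁰` else `inr K`; `inr K ↦ inr K`). [this work] -/
def relRegroup (𝒢 Q 𝒜 ℬ : Finset (Finset α)) (h𝒜 : ∀ K ∈ ℬ, K ∈ 𝒜 ↔ K ∈ 𝒢) :
    (↥(𝒜 ∪ {s ∈ ℬ | s ∈ Q})) ⊕ (↥({s ∈ ℬ | s ∈ 𝒢 ∨ s ∉ Q})) ≃ 𝒜 ⊕ ℬ where
  toFun := fun x => match x with
    | Sum.inl K => if h : (K : Finset α) ∈ 𝒜 then Sum.inl ⟨K.1, h⟩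
        else Sum.inr ⟨K.1, (mem_filter.1 ((mem_union.1 K.2).resolve_left h)).1⟩
    | Sum.inr K => Sum.inr ⟨K.1, (mem_filter.1 K.2).1⟩
  invFun := fun x => match x with
    | Sum.inl K => Sum.inl ⟨K.1, mem_union_left _ K.2⟩
    | Sum.inr K => if h : (K : Finset α) ∈ 𝒢 ∨ (K : Finset α) ∉ Q then Sum.inr ⟨K.1, mem_filter.2 ⟨K.2, h⟩⟩
        else Sum.inl ⟨K.1, mem_union_right _ (mem_filter.2 ⟨K.2, not_not.1 (not_or.1 h).2⟩)⟩
  left_inv := by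
    rintro (K | K)
    · by_cases h : (K : Finset α) ∈ 𝒜
      · simp [h]
      · have hKB : (K : Finset α) ∈ {s ∈ ℬ | s ∈ Q} := (mem_union.1 K.2).resolve_left h
        have hKB' := mem_filter.1 hKB
        have hneg : ¬ ((K : Finset α) ∈ 𝒢 ∨ (K : Finset α) ∉ Q) := by
          rintro (h' | h'); exact h ((h𝒜 _ hKB'.1).2 h'); exact h' hKB'.2
        simp [h, hneg]
    · have h : (K : Finset α) ∈ 𝒢 ∨ (K : Finset α) ∉ Q := (mem_filter.1 K.2).2
      simp [h]
  right_inv := by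
    rintro (K | K)
    · simp [K.2]
    · by_cases h : (K : Finset α) ∈ 𝒢 ∨ (K : Finset α) ∉ Q
      · simp [h]
      · have hnot : (K : Finset α) ∉ 𝒜 := fun h' => h (Or.inl ((h𝒜 _ K.2).1 h'))
        simp [h, hnot]

end SahiFComb.Shift

end Summit.CriticalPhenomena.PercolationContinuityZ3.Theorems
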